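import Summits.RiemannHypothesis.RiemannHypothesis.Theorems.Splittings.JensenX4LaguerreHeredity
import Summits.RiemannHypothesis.RiemannHypothesis.Theses.EarlyAppointments
import HarnessLib

/-!
# `RH ↔ HereditaryLaguerre`; the support item `EarlyAppointments.LaguerreHeredityOfRH` (stmt-RiemannHypothesis-3188);
# the served split `LaguerreSpeiserSplit` charted exactly: `XiPrimeOnLine ∧ LaguerreOnLine ↔ RH ∧ (real zeros of Ξ simple)`

Cell rh-split, seat rh-splitx-theory-1 g3 (batch 4 §13.11/13.12; scratch files `T16HereditaryLaguerreRH.lean` sha16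
0dc20e8ddd0c846d §E and `T17SplitCensus.lean` §F), placed by rh-split-lead g3 RULING #45a as lane (xvii) file 2 of 2,
importing file 1 (`JensenX4LaguerreHeredity`).  Verbatim decl bodies; namespace `Scratch.SplitxTheory1G3e` ↦
`Theorems.Splittings.JensenX4HereditaryLaguerreRH`; `Differentiable ℂ Ξ` / realness are taken from file 1's `Xi_level 0`;
`simple_real_zeros_of_laguerreOnLine` is `private` (a twin is in the crux workfile `Cruxes/LaguerreOnLine/Disproof.lean`).
HONEST LABEL: «SPLITTING SEARCH over kernel-typed RH-EQUIVALENCES; a splitting A ∧ B ⟹ RH is CONDITIONAL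
bookkeeping unless A and B are both proved; nothing here bears on the truth of RH.»

Zero definitions, zero `sorry`.  Content: (E) one Hadamard-free Laguerre step for `Ξ` at every level, `RH ⟹` all zeros
of every `Ξ^{(m)}` real, `RH ⟹ XiPrimeOnLine` (census: crux A is a consequence of RH), the item `LaguerreHeredityOfRH`
(`RH ⟹` hereditary strict Laguerre sign of `t ↦ Re Ξ(t)` at every level), Ki–Kim's direction
`HasNoFourierCriticalPoint (Re Ξ|ℝ) → RH` as typed in the tree (`KiKim.noCrit_re_of_gammaChain`,
`KiKim.im_eq_zero_of_noCrit_of_order_lt_one`, …), and the kernel RH-equivalence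
`riemannHypothesis_iff_hereditaryLaguerre` (route `EarlyAppointments`' rank-0 crux is RH-EQUIVALENT — «Fourier–Pólya form
of RH», Ki–Kim 2000 Thm 1 / Kim 1996; known mathematics, certified here) and, degenerately, that route's assembly
item `earlyAppointments_assembly : EarlyAppointments.Assembly` (stmt-RiemannHypothesis-3189; the first two antecedents unused); (F) the strict Laguerre inequality
`Re f · Re f″ − (Re f′)² < 0` off the zeros for real entire `f` of order `< 2` with only real zeros and at least one zero,
`LaguerreOnLine ⟹` simple real zeros, `RH ∧ (simple real zeros) ⟹ LaguerreOnLine`, and the exact census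
`xiPrimeOnLine_and_laguerreOnLine_iff`.  Every «RH ⟹ …» decl is conditional by construction and credits nothing.
-/

set_option linter.dupNamespace false

noncomputable section

namespace Summit.RiemannHypothesis.RiemannHypothesis.Theorems.Splittings.JensenX4HereditaryLaguerreRH

open Literature.NumberTheory.LFunctions Literature.Analysis.Complex
open Summit.RiemannHypothesis.RiemannHypothesis.Theorems.Splittings.JensenX4LaguerreHeredity
open scoped Real Topology

/-- `Ξ` is entire (from file 1's level bundle). -/
private theorem differentiable_Xi : Differentiable ℂ riemannXiUpper := by
  simpa using (Xi_level 0).1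

/-- `Ξ` is real on the real axis (from file 1's level bundle). -/
private theorem im_Xi_ofReal (x : ℝ) : (riemannXiUpper x).im = 0 := by
  simpa using (Xi_level 0).2.1 x

/-! ## E. `RH ⟹` hereditary strict Laguerre sign for `Ξ` itself; `RH ↔ HereditaryLaguerre` -/

/-- One Laguerre step for `Ξ`: real zeros pass from `Ξ^{(m)}` to `Ξ^{(m+1)}`. -/
theorem zeros_real_iteratedDeriv_succ (m : ℕ)
    (h : ∀ z, iteratedDeriv m riemannXiUpper z = 0 → z.im = 0) :
    ∀ z, iteratedDeriv (m + 1) riemannXiUpper z = 0 → z.im = 0 := by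
  obtain ⟨hd, hreal, ρ, C, hρ0, hρ, hgr⟩ := Xi_level m
  rcases Theorems.UniversalFactor.laguerre_step hd hρ0 hρ hgr hreal h 0 with h' | h'
  · exfalso
    obtain ⟨z, hz⟩ := exists_iteratedDeriv_Xi_ne_zero (m + 1)
    apply hz
    rw [iteratedDeriv_succ]
    simpa using h' z
  · intro z hz
    apply h' z
    rw [iteratedDeriv_succ] at hz
    simp [hz]

/-- Under RH every derivative `Ξ^{(m)}` has only real zeros. -/
theorem zeros_real_iteratedDeriv_of_rh (hRH : _root_.RiemannHypothesis) (m : ℕ) :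
    ∀ z, iteratedDeriv m riemannXiUpper z = 0 → z.im = 0 := by
  induction m with
  | zero =>
    simpa [iteratedDeriv_zero] using
      riemannHypothesis_iff_im_eq_zero_of_riemannXiUpper_eq_zero_holds.1 hRH
  | succ m ih => exact zeros_real_iteratedDeriv_succ m ih

/-- In particular RH ⟹ every zero of `Ξ′` is real (`XiPrimeOnLine`, the served route's crux A,
is a CONSEQUENCE of RH — census, not news). -/
theorem xiPrimeOnLine_of_rh (hRH : _root_.RiemannHypothesis) :
    Theses.LaguerreSpeiserSplit.XiPrimeOnLine := by
  intro z hz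
  exact zeros_real_iteratedDeriv_of_rh hRH 1 z (by simpa [iteratedDeriv_one] using hz)

/-- The strict Laguerre sign at level `m ≥ 0`, given that the zeros of `Ξ^{(m)}` are real. -/
theorem laguerre_sign_Xi_level' (m : ℕ) (hZ : ∀ z, iteratedDeriv m riemannXiUpper z = 0 → z.im = 0)
    (c : ℝ) (h1 : (iteratedDeriv (m + 1) riemannXiUpper c).re = 0)
    (h0 : (iteratedDeriv m riemannXiUpper c).re ≠ 0) :
    (iteratedDeriv m riemannXiUpper c).re * (iteratedDeriv (m + 1 + 1) riemannXiUpper c).re < 0 := by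
  obtain ⟨hd, hreal, ρ, C, hρ0, hρ, hgr⟩ := Xi_level m
  have hreal1 := (Xi_level (m + 1)).2.1
  have hx1 : deriv (iteratedDeriv m riemannXiUpper) c = 0 := by
    rw [← iteratedDeriv_succ]
    exact Complex.ext (by simpa using h1) (by simpa using hreal1 c)
  have hx0 : iteratedDeriv m riemannXiUpper c ≠ 0 := fun h ↦ h0 (by rw [h]; simp)
  have hnc : ∃ z, deriv (iteratedDeriv m riemannXiUpper) z ≠ 0 := by
    rw [← iteratedDeriv_succ]
    exact exists_iteratedDeriv_Xi_ne_zero (m + 1)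
  have key := laguerre_sign hd hρ0 hρ hgr hreal hZ hnc c hx1 hx0
  rwa [← iteratedDeriv_succ, ← iteratedDeriv_succ] at key

/-- **The support item `LaguerreHeredityOfRH` (stmt-RiemannHypothesis-3188) holds**: RH implies
the hereditary strict Laguerre sign for `t ↦ Re Ξ(t)` at every level. -/
theorem laguerreHeredityOfRH : Theses.EarlyAppointments.LaguerreHeredityOfRH := by
  intro hRH k x h1 h0
  have hg : ∀ n, iteratedDeriv n (fun t : ℝ ↦ (riemannXiUpper (t : ℂ)).re) =
      fun t : ℝ ↦ (iteratedDeriv n riemannXiUpper (t : ℂ)).re :=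
    fun n ↦ KiKim.iteratedDeriv_re_ofReal differentiable_Xi n
  simp only [hg] at h1 h0 ⊢
  exact laguerre_sign_Xi_level' k (zeros_real_iteratedDeriv_of_rh hRH k) x h1 h0

/-- Ki–Kim's direction, as typed in the tree (same term as T14's
`rh_of_hasNoFourierCriticalPoint_reXi`, copied so that this file stands alone): the hereditary
strict Laguerre sign for `Re Ξ` forces all zeros of `Ξ` onto the real axis. -/
theorem rh_of_hasNoFourierCriticalPoint_reXi
    (hX : HasNoFourierCriticalPoint (fun t : ℝ => (riemannXiUpper (t : ℂ)).re)) :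
    _root_.RiemannHypothesis := by
  classical
  have hreal : ∀ z : ℂ, riemannXiUpper z = 0 → z.im = 0 := by
    let G : ℂ → ℂ := fun w => xiSq (-w)
    have G_sq : ∀ z : ℂ, G (z ^ 2) = riemannXiUpper z := by
      intro z
      show xiSq (-(z ^ 2)) = _
      rw [Theorems.Splittings.JensenX4RowsFromOneXiPrime.riemannXiUpper_eq_xiSq]
    have hGd : Differentiable ℂ G := differentiable_xiSq.comp differentiable_neg
    have G_real : ∀ x : ℝ, (G x).im = 0 := by
      intro x
      have h : (starRingEnd ℂ) (xiSq (-(x : ℂ))) = xiSq (-(x : ℂ)) := by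
        rw [← xiSq_conj, map_neg, Complex.conj_ofReal]
      exact Complex.conj_eq_iff_im.mp h
    have G_zero_ne : G 0 ≠ 0 := by
      show xiSq (-0) ≠ 0
      rw [neg_zero]
      exact xiSq_zero_ne
    have G_zero_re_ne : (G 0).re ≠ 0 := by
      intro hre
      apply G_zero_ne
      apply Complex.ext
      · simpa using hre
      · simpa using G_real 0
    obtain ⟨C, hC⟩ := norm_xiSq_le
    have G_orderLtOne : IsEntireOfOrderLt 1 G := by
      refine ⟨hGd, 7 / 8, C, by norm_num, fun w => ?_⟩
      have h := hC (-w)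
      rw [norm_neg] at h
      exact h
    have hHγ : HasNoFourierCriticalPoint (fun s : ℝ => (G ((s : ℂ) ^ 2)).re) := by
      have h : (fun s : ℝ => (G ((s : ℂ) ^ 2)).re) = fun t : ℝ => (riemannXiUpper (t : ℂ)).re := by
        funext s; rw [G_sq]
      rw [h]
      exact hX
    have hHG : HasNoFourierCriticalPoint (fun t : ℝ => (G t).re) :=
      KiKim.noCrit_re_of_gammaChain hGd G_real G_zero_re_ne hHγ
    intro z hz
    have hzsq : G (z ^ 2) = 0 := by rw [G_sq]; exact hz
    have him2 : (z ^ 2).im = 0 :=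
      KiKim.im_eq_zero_of_noCrit_of_order_lt_one G_orderLtOne G_zero_ne G_real hHG (z ^ 2) hzsq
    have hre2 : 0 ≤ (z ^ 2).re := by
      by_contra hneg
      push Not at hneg
      have halt := KiKim.re_iteratedDeriv_zero_mul_succ_neg hGd G_zero_re_ne hHγ
      have h1' := KiKim.re_iteratedDeriv_ne_zero_of_neg hGd G_real halt 0 hneg
      have h2' : z ^ 2 = (((z ^ 2).re : ℝ) : ℂ) := Complex.ext (by simp) (by simpa using him2)
      rw [h2'] at hzsq
      simp only [iteratedDeriv_zero] at h1'
      exact h1' (by rw [hzsq]; simp)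
    have him : (z ^ 2).im = 2 * z.re * z.im := by simp [sq, Complex.mul_im]; ring
    have hre : (z ^ 2).re = z.re * z.re - z.im * z.im := by simp [sq, Complex.mul_re]
    rw [him] at him2
    rw [hre] at hre2
    by_contra hzim
    have hzre : z.re = 0 := by
      rcases mul_eq_zero.1 him2 with h | h
      · rcases mul_eq_zero.1 h with h' | h'
        · norm_num at h'
        · exact h'
      · exact absurd h hzim
    rw [hzre] at hre2
    have : 0 < z.im * z.im := mul_self_pos.mpr hzim
    linarith
  exact riemannHypothesis_iff_im_eq_zero_of_riemannXiUpper_eq_zero_holds.2 hreal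

/-- **Kernel RH-equivalence:** `RH ↔ HereditaryLaguerre` — the rank-0 crux of route
`EarlyAppointments` (stmt-RiemannHypothesis-3182, "Fourier–Pólya form of RH") is RH-EQUIVALENT,
both directions checked. -/
theorem riemannHypothesis_iff_hereditaryLaguerre :
    _root_.Summit.RiemannHypothesis ↔ Theses.EarlyAppointments.HereditaryLaguerre :=
  ⟨laguerreHeredityOfRH, fun h ↦ rh_of_hasNoFourierCriticalPoint_reXi h⟩

/-- Read-back for the cell's row C1: under RH both «A» (`XiPrimeOnLine`) and the hereditary sign
law for `Re Ξ′` hold, so the served split's A-side and heredity side are CONSEQUENCES of RH. -/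
theorem hasNoFourierCriticalPoint_deriv_of_rh (hRH : _root_.RiemannHypothesis) :
    HasNoFourierCriticalPoint (fun t : ℝ => (deriv riemannXiUpper (t : ℂ)).re) :=
  laguerreHeredityOfXiPrime (xiPrimeOnLine_of_rh hRH)

/-- **Route `EarlyAppointments`' assembly item (stmt-RiemannHypothesis-3189) holds — DEGENERATELY:** with Ki–Kim's
direction in the tree, `HereditaryLaguerre` alone gives `RiemannHypothesis`, so the implication
`LogCombLandingLaw → XiInLogCombClass → HereditaryLaguerre → RH` is proved ignoring its first two antecedents.
Honest reading: this certifies the typed assembly and records that the route's content sits entirely in its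
rank-0 crux `HereditaryLaguerre` (RH-equivalent, `riemannHypothesis_iff_hereditaryLaguerre`); it credits nothing
toward RH. -/
theorem earlyAppointments_assembly : Theses.EarlyAppointments.Assembly :=
  fun _ _ h ↦ riemannHypothesis_iff_hereditaryLaguerre.2 h

/-! ## F. The B-side: `LaguerreOnLine ↔ simple real zeros` under RH; the split's exact census -/

/-- **Strict Laguerre inequality off the zeros.** Let `f` be entire, of order `< 2`
quantitatively, real on `ℝ`, with only real zeros and at least one zero. Then at every real `x`
with `f(x) ≠ 0`: `Re f(x) · Re f″(x) − (Re f′(x))² < 0`, i.e. `(f′/f)′(x) < 0`. (For zero-free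
`f = e^{cz}` the left side vanishes, so the zero is needed.) [folklore; Laguerre] -/
theorem laguerre_strict {f : ℂ → ℂ} (hf : Differentiable ℂ f) {ρ C : ℝ} (hρ0 : 0 ≤ ρ)
    (hρ : ρ < 2) (hgr : ∀ z, ‖f z‖ ≤ C * Real.exp (‖z‖ ^ ρ)) (hreal : ∀ x : ℝ, (f x).im = 0)
    (hzero : ∀ z, f z = 0 → z.im = 0) (hex : ∃ a, f a = 0) (x : ℝ) (hx0 : f x ≠ 0) :
    (f x).re * (deriv (deriv f) x).re - (deriv f x).re ^ 2 < 0 := by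
  have hd : Differentiable ℂ (deriv f) := by
    simpa [iteratedDeriv_one] using differentiable_iteratedDeriv_of_entire hf 1
  obtain ⟨a, ha⟩ := hex
  have ha_im : a.im = 0 := hzero a ha
  have hw_im : (deriv f x).im = 0 := by
    have := im_iteratedDeriv_ofReal hf hreal 1 x
    rwa [iteratedDeriv_one] at this
  have hv_im : (deriv (deriv f) x).im = 0 := by
    have := im_iteratedDeriv_ofReal hf hreal 2 x
    rwa [show (2 : ℕ) = 1 + 1 from rfl, iteratedDeriv_succ, iteratedDeriv_one] at this
  set u : ℝ := (f x).re with hu_def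
  set v : ℝ := (deriv (deriv f) x).re with hv_def
  set w : ℝ := (deriv f x).re with hw_def
  have hu : f x = (u : ℂ) := Complex.ext (by simp [hu_def]) (by simp [hreal x])
  have hv : deriv (deriv f) x = (v : ℂ) := Complex.ext (by simp [hv_def]) (by simp [hv_im])
  have hw : deriv f x = (w : ℂ) := Complex.ext (by simp [hw_def]) (by simp [hw_im])
  have hu0 : u ≠ 0 := fun h0 ↦ hx0 (by rw [hu, h0]; simp)
  -- the logarithmic derivative `q` near `x`
  set q : ℂ → ℂ := fun z ↦ deriv f z / f z with hq_def
  have hqx : DifferentiableAt ℂ q x := (hd.differentiableAt).div (hf.differentiableAt) hx0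
  have hdq : deriv q x = (((v * u - w * w) / u ^ 2 : ℝ) : ℂ) := by
    have hq' : q = deriv f / f := by rw [hq_def]; rfl
    rw [hq', deriv_div hd.differentiableAt hf.differentiableAt hx0, hu, hv, hw]
    push_cast
    ring
  -- the vertical slice
  set h : ℂ → ℂ := fun z ↦ q ((x : ℂ) + Complex.I * z) with hh_def
  have hlin : HasDerivAt (fun z : ℂ ↦ (x : ℂ) + Complex.I * z) Complex.I 0 := by
    simpa using ((hasDerivAt_id (0 : ℂ)).const_mul Complex.I).const_add (x : ℂ)
  have hqx' : HasDerivAt q (deriv q x) ((x : ℂ) + Complex.I * 0) := by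
    simpa using hqx.hasDerivAt
  have hh : HasDerivAt h (deriv q x * Complex.I) 0 := by
    rw [hh_def]
    exact (hqx'.comp 0 hlin :)
  have hh0 : DifferentiableAt ℂ h ((0 : ℝ) : ℂ) := by
    rw [Complex.ofReal_zero]; exact hh.differentiableAt
  have hφ' : HasDerivAt (fun s : ℝ ↦ (h s).im) (deriv q x).re 0 := by
    have := KiKim.hasDerivAt_im_ofReal hh0
    rw [Complex.ofReal_zero, hh.deriv] at this
    simpa using this
  have hφ0 : (h ((0 : ℝ) : ℂ)).im = 0 := by
    simp only [hh_def, hq_def, Complex.ofReal_zero, mul_zero, add_zero]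
    rw [hu, hw, ← Complex.ofReal_div, Complex.ofReal_im]
  have hT := hφ'.tendsto_slope_zero_right
  set R : ℝ := ‖(x : ℂ) - a‖ + 1 with hR
  have hRpos : 0 < R := by positivity
  have hbound : ∀ᶠ t in 𝓝[>] (0 : ℝ),
      t⁻¹ • ((fun s : ℝ ↦ (h s).im) (0 + t) - (fun s : ℝ ↦ (h s).im) 0) ≤ -(1 / R ^ 2) := by
    filter_upwards [Ioo_mem_nhdsGT (zero_lt_one' ℝ)] with t ht
    obtain ⟨ht0, ht1⟩ := ht
    simp only [zero_add, smul_eq_mul]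
    rw [hφ0, sub_zero]
    set z : ℂ := (x : ℂ) + Complex.I * t with hz
    have hzim : z.im = t := by simp [hz]
    have hzim' : z.im ≠ 0 := by rw [hzim]; exact ht0.ne'
    have key := im_mul_im_logDeriv_le hf hρ0 hρ hgr hreal hzero hzim' ha
    rw [hzim] at key
    have hhz : h t = deriv f z / f z := by simp [hh_def, hq_def, hz]
    rw [hhz]
    have hza_pos : 0 < ‖z - a‖ := by
      rw [norm_pos_iff, sub_ne_zero]
      intro hza; rw [hza, ha_im] at hzim; exact ht0.ne hzim
    have hza_le : ‖z - a‖ ≤ R := by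
      calc ‖z - a‖ = ‖((x : ℂ) - a) + Complex.I * t‖ := by rw [hz]; ring_nf
        _ ≤ ‖(x : ℂ) - a‖ + ‖Complex.I * (t : ℂ)‖ := norm_add_le _ _
        _ ≤ ‖(x : ℂ) - a‖ + 1 := by
            gcongr
            rw [norm_mul, Complex.norm_I, one_mul, Complex.norm_real, Real.norm_eq_abs,
              abs_of_pos ht0]
            exact ht1.le
    have hN : 0 < ‖z - a‖ ^ 2 := by positivity
    have h1 : t⁻¹ * (deriv f z / f z).im ≤ -(1 / ‖z - a‖ ^ 2) := by
      rw [inv_mul_le_iff₀ ht0]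
      refine le_of_mul_le_mul_left ?_ ht0
      calc t * (deriv f z / f z).im ≤ -(t ^ 2 / ‖z - a‖ ^ 2) := key
        _ = t * (t * -(1 / ‖z - a‖ ^ 2)) := by ring
    have h2 : -(1 / ‖z - a‖ ^ 2) ≤ -(1 / R ^ 2) := by
      apply neg_le_neg
      apply one_div_le_one_div_of_le hN
      exact pow_le_pow_left₀ hza_pos.le hza_le 2
    exact h1.trans h2
  have hlim : (deriv q x).re ≤ -(1 / R ^ 2) := le_of_tendsto hT hbound
  have hneg : (deriv q x).re < 0 := by
    have : 0 < 1 / R ^ 2 := by positivity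
    linarith
  rw [hdq, Complex.ofReal_re] at hneg
  have hnum : v * u - w * w < 0 := by
    by_contra hcon
    push Not at hcon
    have : 0 ≤ (v * u - w * w) / u ^ 2 := div_nonneg hcon (by positivity)
    linarith
  nlinarith [hnum]

/-- The real-variable integrand of `LaguerreOnLine` in terms of `Ξ′, Ξ″`:
`(Re Ξ)′(t) = Re Ξ′(t)` and `(Re Ξ)″(t) = Re Ξ″(t)`. -/
theorem laguerreOnLine_terms (t : ℝ) :
    deriv (fun u : ℝ ↦ (riemannXiUpper (u : ℂ)).re) t = (deriv riemannXiUpper (t : ℂ)).re ∧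
    iteratedDeriv 2 (fun u : ℝ ↦ (riemannXiUpper (u : ℂ)).re) t =
      (deriv (deriv riemannXiUpper) (t : ℂ)).re := by
  constructor
  · have := congrFun (KiKim.iteratedDeriv_re_ofReal differentiable_Xi 1) t
    simpa [iteratedDeriv_one] using this
  · have := congrFun (KiKim.iteratedDeriv_re_ofReal differentiable_Xi 2) t
    rw [this, show (2 : ℕ) = 1 + 1 from rfl, iteratedDeriv_succ, iteratedDeriv_one]

/-- **B ⟹ every real zero of `Ξ` is simple** (unconditional: at a real zero the integrand of
`LaguerreOnLine` is `Ξ′(t)²`).  Private: a twin `simpleRealZeros_of_laguerreOnLine` sits in the crux workfile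
`Cruxes/LaguerreOnLine/Disproof.lean`. -/
private theorem simple_real_zeros_of_laguerreOnLine (hB : Theses.LaguerreSpeiserSplit.LaguerreOnLine)
    (t : ℝ) (ht : riemannXiUpper t = 0) : deriv riemannXiUpper t ≠ 0 := by
  intro hd0
  have h := hB t
  obtain ⟨h1, h2⟩ := laguerreOnLine_terms t
  rw [h1, h2, ht, hd0] at h
  simp at h

/-- **RH ∧ (simple real zeros) ⟹ B.** Off the zeros this is the strict Laguerre inequality
`laguerre_strict` for `Ξ` (zeros real by RH, a zero exists); at a real zero `t` the integrand is
`Ξ′(t)² > 0` by simplicity. -/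
theorem laguerreOnLine_of_rh_of_simple (hRH : _root_.RiemannHypothesis)
    (hSZ : ∀ t : ℝ, riemannXiUpper t = 0 → deriv riemannXiUpper t ≠ 0) :
    Theses.LaguerreSpeiserSplit.LaguerreOnLine := by
  intro t
  obtain ⟨h1, h2⟩ := laguerreOnLine_terms t
  rw [h1, h2]
  have hzero := zeros_real_iteratedDeriv_of_rh hRH 0
  simp only [iteratedDeriv_zero] at hzero
  obtain ⟨C, hC⟩ := exists_growth_Xi
  have hex : ∃ a, riemannXiUpper a = 0 := infinite_setOf_Xi_eq_zero.nonempty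
  by_cases ht : riemannXiUpper t = 0
  · have hd0 := hSZ t ht
    have hw_im : (deriv riemannXiUpper t).im = 0 := by
      have := (Xi_level 1).2.1 t
      rwa [iteratedDeriv_one] at this
    have hw : (deriv riemannXiUpper t).re ≠ 0 := fun h ↦ hd0 (Complex.ext (by simpa using h) (by simpa using hw_im))
    rw [ht]
    simp only [Complex.zero_re, zero_mul, sub_zero]
    positivity
  · have key := laguerre_strict differentiable_Xi (by norm_num) (by norm_num) hC im_Xi_ofReal hzero
      hex t ht
    linarith

/-- **The served split charted exactly (kernel census of row C1 / X-4):**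
`XiPrimeOnLine ∧ LaguerreOnLine ↔ RH ∧ (every real zero of Ξ is simple)`.
`→`: the route's `closes` with the support item discharged (section D), and B at the real zeros;
`←`: Laguerre heredity from level 0 (section E) and the strict Laguerre inequality (section F).
Under RH all zeros of `Ξ` are real, so the right-hand side is «RH ∧ SZ» (all zeros of `ξ` simple):
B's only RH-independent content is simplicity. Nothing here bears on the truth of RH or SZ. -/
theorem xiPrimeOnLine_and_laguerreOnLine_iff :
    (Theses.LaguerreSpeiserSplit.XiPrimeOnLine ∧ Theses.LaguerreSpeiserSplit.LaguerreOnLine) ↔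
    (_root_.RiemannHypothesis ∧ ∀ t : ℝ, riemannXiUpper t = 0 → deriv riemannXiUpper t ≠ 0) :=
  ⟨fun h ↦ ⟨rh_of_xiPrimeOnLine_of_laguerreOnLine h.1 h.2, simple_real_zeros_of_laguerreOnLine h.2⟩,
    fun h ↦ ⟨xiPrimeOnLine_of_rh h.1, laguerreOnLine_of_rh_of_simple h.1 h.2⟩⟩

end Summit.RiemannHypothesis.RiemannHypothesis.Theorems.Splittings.JensenX4HereditaryLaguerreRH

end
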